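import Mathlib
import Summits.NavierStokesRegularity.NavierStokesRegularity.Theorems.EulerZoomLiouvillePowerGaugeEulerLiouvilleNeedleHoveringPast
import Summits.NavierStokesRegularity.NavierStokesRegularity.Theorems.EulerZoomLiouvillePowerGaugeEulerLiouvilleNeedleClockLocal
import HarnessLib

/-!
# «ONE CLOCKED BALL KILLS», II: the HOVERING LAW is local too
# (crux `EulerZoomLiouville.PowerGaugeEulerLiouville` = stmt-NavierStokesRegularity-19832, THE ONE STATEMENT `stub_selfSimilarC2Needle`; binder `HasResidenceClock` alt 7)

Route `EulerZoomLiouville` (NavierStokesRegularity), crux E, LEAD seat ns-typeII-p2 g13 (own brick #6, sequel of `…NeedleClockLocal`).  ns-ezl-w2 g3's clock reduction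
`NeedleRace.effectiveClock_of_hoveringLaw` (ROUND-39 (CR), `…NeedleClockReduction`) turns the HOVERING LAW at a vortical point into the effective clock AT THAT POINT and never
uses the vorticity of the point; with the local threshold `NeedleRace.selfSimilar_ae_eq_zero_of_localPowerClockC2` (this seat, p676660) the hovering law AT ONE BALL kills:

* `NeedleRace.effectiveClockAt_of_hoveringLawAt` — profile level: Bernoulli oscillation `≤ C r^θ`, the room condition, and the hovering law at ONE ball `B(x₀, r)` (`x₀`
  arbitrary) ⇒ the power residence clock at that ball (the reduction's proof verbatim, minus `intro x₀ hx₀`);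
* `NeedleRace.selfSimilar_ae_eq_zero_of_localHoveringLawC2` / `…_past` — member level (crux hypotheses verbatim, `0 < ρ ≤ ½`, exact self-similarity about the origin /
  about `(T, x₀)` for `τ < T₁`, `V ∈ C²`, Bernoulli oscillation exponent `θ < 2+ρ`): the hypothesis `hhover` of `…hoveringLawC2` / `…_past` with
  `∀ x₀, curl V x₀ ≠ 0 → ∃ r …` REPLACED BY `∃ x₀ r …` (for every `c′ > 0` SOME ball at most a quarter of whose labels linger in `‖·‖ ≤ 2R` AND hover — `‖W‖ < R^{−(2+ρ−θ)/4}`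
  for half of the window `c′R^{2+ρ}` — all large `R`, every cut-off copy) ⇒ `u = 0` a.e.

For the skeleton (LEAD, v91): `HasResidenceClock ρ V` gains ALTERNATIVE 7 = envelope + LOCAL hovering law (fillers: these two theorems).  For the condenser programme (T-E):
hovering lingerers need to be rare in ONE ball only.
WHAT THIS IS NOT: not NS, not E — the clock reduction read locally; no new estimate; DENT 0 on the registered stubs; 19832 OPEN; NS regularity is NOT proved.
[folklore; ConstantinIgnatovaVicol2026Putative §3.4.2 (3.31), §3.5]
-/

noncomputable section

-- flat `Theorems/<Route><Decl>…` files of one crux share the namespace of the crux (tree convention: `Summit.<S>.<S>.…`)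
set_option linter.dupNamespace false

open Set Filter Topology Metric Function MeasureTheory InnerProductSpace
open scoped RealInnerProductSpace NNReal ENNReal

namespace Summit.NavierStokesRegularity.NavierStokesRegularity.Theorems.PowerGaugeEulerLiouville.NeedleRace

open Literature.Analysis Literature.Analysis.FluidPDE Literature.Analysis.FunctionSpaces
open Summit.NavierStokesRegularity.NavierStokesRegularity.Theorems.PowerGaugeEulerLiouville

section Profile

variable {γ : ℝ} {U : EuclideanSpace ℝ (Fin 3) → EuclideanSpace ℝ (Fin 3)} {P : EuclideanSpace ℝ (Fin 3) → ℝ}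

/-- **THE CLOCK REDUCTION AT ONE BALL.**  Bernoulli oscillation `≤ C r^θ` + room condition `2^{2+θ} C R^θ ≤ (1−2γ) c′ δ(R)² R^e` eventually + the hovering law at
strength `c′R^e` and scale `δ` AT ONE BALL `B(x₀, r)` (`x₀` arbitrary) ⇒ the effective clock of strength `c′R^e` at that ball.
= `effectiveClock_of_hoveringLaw` read locally. [cite: ConstantinIgnatovaVicol2026Putative, §3.4.2 eq. (3.31)] -/
theorem effectiveClockAt_of_hoveringLawAt (hprof : IsSelfSimilarEulerProfile γ 0 U P) (hγ2 : γ < 1 / 2)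
    {θ C c' e : ℝ} (hc' : 0 < c')
    (hosc : ∀ r : ℝ, 1 ≤ r → ∀ y y' : EuclideanSpace ℝ (Fin 3), ‖y‖ ≤ r → ‖y'‖ ≤ r →
      selfSimilarBernoulli γ 0 U P y - selfSimilarBernoulli γ 0 U P y' ≤ C * r ^ θ)
    {δ : ℝ → ℝ} (hδ : ∀ R : ℝ, 1 ≤ R → 0 < δ R)
    (hroom : ∃ R₁ : ℝ, ∀ R : ℝ, R₁ ≤ R → (2 : ℝ) ^ (2 + θ) * C * R ^ θ ≤ (1 - 2 * γ) * c' * δ R ^ 2 * R ^ e)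
    {x₀ : EuclideanSpace ℝ (Fin 3)} {r : ℝ} (hr : 0 < r) {R₀ : ℝ} (hR₀ : ∀ R : ℝ, R₀ ≤ R →
      ∀ (V : EuclideanSpace ℝ (Fin 3) → EuclideanSpace ℝ (Fin 3)) (K Rbig : ℝ), ContDiff ℝ 2 V →
        (∀ y, ‖fderiv ℝ V y‖ ≤ K) → 2 * R < Rbig → (∀ w ∈ ball (0 : EuclideanSpace ℝ (Fin 3)) Rbig, V w = U w) →
        (volume (ball x₀ r ∩ {a | ∀ σ ∈ Icc 0 (c' * R ^ e),
            ‖ODE.evolutionMap (fun _ : ℝ => selfSimilarTransport γ 0 V) 0 (-σ) a‖ ≤ 2 * R} ∩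
          {a | c' * R ^ e / 2 ≤ (volume {σ ∈ Icc 0 (c' * R ^ e) |
            ‖selfSimilarTransport γ 0 V (ODE.evolutionMap (fun _ : ℝ => selfSimilarTransport γ 0 V) 0 (-σ) a)‖ <
              δ R}).toReal})).toReal ≤ (volume (ball x₀ r)).toReal / 4) :
    ∃ r : ℝ, 0 < r ∧ ∃ R₀ : ℝ, ∀ R : ℝ, R₀ ≤ R →
      ∀ (V : EuclideanSpace ℝ (Fin 3) → EuclideanSpace ℝ (Fin 3)) (K Rbig : ℝ), ContDiff ℝ 2 V →
        (∀ y, ‖fderiv ℝ V y‖ ≤ K) → 2 * R < Rbig → (∀ w ∈ ball (0 : EuclideanSpace ℝ (Fin 3)) Rbig, V w = U w) →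
        (volume (ball x₀ r ∩ {a | ∀ σ ∈ Icc 0 (c' * R ^ e),
            ‖ODE.evolutionMap (fun _ : ℝ => selfSimilarTransport γ 0 V) 0 (-σ) a‖ ≤ 2 * R})).toReal ≤
          (volume (ball x₀ r)).toReal / 2 := by
  have h12 : 0 < 1 - 2 * γ := by linarith
  obtain ⟨R₁, hR₁⟩ := hroom
  refine ⟨r, hr, max R₀ (max R₁ 1), fun R hR V K Rbig hV2 hK hRbig hVU => ?_⟩
  have hRR₀ : R₀ ≤ R := (le_max_left _ _).trans hR
  have hRR₁ : R₁ ≤ R := ((le_max_left _ _).trans (le_max_right _ _)).trans hR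
  have hR1 : 1 ≤ R := ((le_max_right _ _).trans (le_max_right _ _)).trans hR
  have hR0 : 0 < R := by linarith
  have hV1 : ContDiff ℝ 1 V := hV2.of_le (by norm_num)
  set L : ℝ := c' * R ^ e with hL
  have hL0 : 0 ≤ L := mul_nonneg hc'.le (Real.rpow_nonneg hR0.le _)
  set Φ := ODE.evolutionMap (fun _ : ℝ => selfSimilarTransport γ 0 V) 0 with hΦ
  set B : Set (EuclideanSpace ℝ (Fin 3)) := ball x₀ r with hB
  set Linger : Set (EuclideanSpace ℝ (Fin 3)) := {a | ∀ σ ∈ Icc 0 L, ‖Φ (-σ) a‖ ≤ 2 * R} with hLinger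
  set Hover : Set (EuclideanSpace ℝ (Fin 3)) := {a | L / 2 ≤ (volume {σ ∈ Icc 0 L |
      ‖selfSimilarTransport γ 0 V (Φ (-σ) a)‖ < δ R}).toReal} with hHover
  have hhov := hR₀ R hRR₀ V K Rbig hV2 hK hRbig hVU
  -- ### every lingering label hovers
  have hkey : ∀ a ∈ Linger, a ∈ Hover := by
    intro a ha
    -- the fast time along the orbit of `a`
    have hfast := NeedleClock.volume_fastTime_le_of_linger (γ := γ) hprof hγ2 hV1 hK hRbig hVU hL0 ha (hδ R hR1)
    -- the Bernoulli gain is at most the oscillation on `B̄_{2R}`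
    have h2R1 : 1 ≤ 2 * R := by linarith
    have hend : ‖Φ (-L) a‖ ≤ 2 * R := ha L ⟨hL0, le_rfl⟩
    have hstart : ‖a‖ ≤ 2 * R := by
      have h0 := ha 0 ⟨le_rfl, hL0⟩
      rwa [neg_zero, hΦ, ODE.evolutionMap_self] at h0
    have hgain : selfSimilarBernoulli γ 0 U P (Φ (-L) a) - selfSimilarBernoulli γ 0 U P a ≤ C * (2 * R) ^ θ :=
      hosc (2 * R) h2R1 _ _ hend hstart
    -- the room condition: `C (2R)^θ / ((1−2γ) δ²) ≤ L/4`
    have hroomR := hR₁ R hRR₁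
    have hδ2 : 0 < δ R ^ 2 := pow_pos (hδ R hR1) 2
    have hF : C * (2 * R) ^ θ / ((1 - 2 * γ) * δ R ^ 2) ≤ L / 4 := by
      rw [div_le_iff₀ (by positivity), Real.mul_rpow (by norm_num) hR0.le]
      have h4 : (2 : ℝ) ^ (2 + θ) = 4 * (2 : ℝ) ^ θ := by
        rw [Real.rpow_add two_pos, Real.rpow_two]; ring
      rw [h4] at hroomR
      rw [hL]
      nlinarith [hroomR]
    have hx : (selfSimilarBernoulli γ 0 U P (Φ (-L) a) - selfSimilarBernoulli γ 0 U P a) / ((1 - 2 * γ) * δ R ^ 2) ≤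
        L / 4 := (div_le_div_of_nonneg_right hgain (by positivity)).trans hF
    have hfast' : (volume {σ ∈ Icc 0 L |
        δ R ≤ ‖selfSimilarTransport γ 0 U (Φ (-σ) a)‖}).toReal ≤ L / 4 := by
      refine (ENNReal.toReal_mono ENNReal.ofReal_ne_top hfast).trans ?_
      rw [ENNReal.toReal_ofReal']
      exact max_le hx (by positivity)
    -- on lingering orbits the cut-off field is the profile field
    have hWeq : ∀ σ ∈ Icc 0 L, selfSimilarTransport γ 0 V (Φ (-σ) a) = selfSimilarTransport γ 0 U (Φ (-σ) a) := by
      intro σ hσ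
      have hin : Φ (-σ) a ∈ ball (0 : EuclideanSpace ℝ (Fin 3)) Rbig :=
        mem_ball_zero_iff.2 (lt_of_le_of_lt (ha σ hσ) hRbig)
      simp only [selfSimilarTransport_apply, hVU _ hin]
    -- slow + fast ⊇ [0, L]
    set Fast : Set ℝ := {σ ∈ Icc 0 L | δ R ≤ ‖selfSimilarTransport γ 0 U (Φ (-σ) a)‖} with hFast
    set Slow : Set ℝ := {σ ∈ Icc 0 L | ‖selfSimilarTransport γ 0 V (Φ (-σ) a)‖ < δ R} with hSlow
    have hcover : Icc (0 : ℝ) L ⊆ Slow ∪ Fast := by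
      intro σ hσ
      by_cases hlt : ‖selfSimilarTransport γ 0 V (Φ (-σ) a)‖ < δ R
      · exact Or.inl ⟨hσ, hlt⟩
      · right
        refine ⟨hσ, ?_⟩
        rw [← hWeq σ hσ]
        exact not_lt.1 hlt
    have hSlow_fin : volume Slow ≠ ⊤ :=
      ((measure_mono (fun σ hσ => hσ.1)).trans_lt (by rw [Real.volume_Icc]; exact ENNReal.ofReal_lt_top)).ne
    have hFast_fin : volume Fast ≠ ⊤ :=
      ((measure_mono (fun σ hσ => hσ.1)).trans_lt (by rw [Real.volume_Icc]; exact ENNReal.ofReal_lt_top)).ne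
    have hsum : L ≤ (volume Slow).toReal + (volume Fast).toReal := by
      have h1 : volume (Icc (0 : ℝ) L) ≤ volume Slow + volume Fast :=
        (measure_mono hcover).trans (measure_union_le _ _)
      rw [Real.volume_Icc, sub_zero] at h1
      have h2 := ENNReal.toReal_mono (ENNReal.add_ne_top.2 ⟨hSlow_fin, hFast_fin⟩) h1
      rwa [ENNReal.toReal_ofReal hL0, ENNReal.toReal_add hSlow_fin hFast_fin] at h2
    show L / 2 ≤ (volume Slow).toReal
    linarith
  -- ### monotonicity
  have hsub : B ∩ Linger ⊆ B ∩ Linger ∩ Hover := fun a ha => ⟨ha, hkey a ha.2⟩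
  have hfin : volume (B ∩ Linger ∩ Hover) ≠ ⊤ :=
    ((measure_mono (fun a ha => ha.1.1)).trans_lt measure_ball_lt_top).ne
  have hv0 : 0 ≤ (volume B).toReal := ENNReal.toReal_nonneg
  calc (volume (B ∩ Linger)).toReal ≤ (volume (B ∩ Linger ∩ Hover)).toReal := ENNReal.toReal_mono hfin (measure_mono hsub)
    _ ≤ (volume B).toReal / 4 := hhov
    _ ≤ (volume B).toReal / 2 := by linarith

end Profile

section Member

variable {V : EuclideanSpace ℝ (Fin 3) → EuclideanSpace ℝ (Fin 3)}

/-- **THE HOVERING THRESHOLD AT ONE BALL (member level).**  = `selfSimilar_ae_eq_zero_of_hoveringLawC2` with `∀ x₀, curl V x₀ ≠ 0 → ∃ r …` replaced by `∃ x₀ r …`;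
closes through `selfSimilar_ae_eq_zero_of_localPowerClockC2`. [cite: ConstantinIgnatovaVicol2026Putative, §3.4.2 eq. (3.31)] -/
theorem selfSimilar_ae_eq_zero_of_localHoveringLawC2 {ρ : ℝ} (hρ : 0 < ρ) (hρ1 : ρ ≤ 1 / 2)
    {u : ℝ → EuclideanSpace ℝ (Fin 3) → EuclideanSpace ℝ (Fin 3)} {p : ℝ → EuclideanSpace ℝ (Fin 3) → ℝ}
    {H : ℝ → EuclideanSpace ℝ (Fin 3) → EuclideanSpace ℝ (Fin 3) →L[ℝ] EuclideanSpace ℝ (Fin 3)} {c : ℝ≥0}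
    (hsw : IsSuitableWeakSolutionOn (slab (EuclideanSpace ℝ (Fin 3)) (Iio 0) isOpen_Iio) 0 0 u p)
    (hH : HasWeakSpatialGradientOn (slab (EuclideanSpace ℝ (Fin 3)) (Iio 0) isOpen_Iio) u H)
    (hgauge : ∀ a : ℝ, 0 < a →
      ENNReal.ofReal (a ^ (2 * ρ)) * cknA a (0 : ℝ × EuclideanSpace ℝ (Fin 3)) u +
          ENNReal.ofReal (a ^ ρ) * cknE a (0 : ℝ × EuclideanSpace ℝ (Fin 3)) H +
        ENNReal.ofReal (a ^ (2 * ρ)) * cknD a (0 : ℝ × EuclideanSpace ℝ (Fin 3)) p ≤ (c : ℝ≥0∞))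
    {P : EuclideanSpace ℝ (Fin 3) → ℝ}
    (hu : ∀ τ : ℝ, τ < 0 → u τ = selfSimilarCollapse (1 / (2 + ρ)) 0 V τ)
    (hp : ∀ τ : ℝ, τ < 0 → p τ = selfSimilarCollapsePressure (1 / (2 + ρ)) 0 P τ)
    (hV : ContDiff ℝ 2 V) {θ : ℝ} (hθ : θ < 2 + ρ)
    (hosc : ∀ P' : EuclideanSpace ℝ (Fin 3) → ℝ, IsSelfSimilarEulerProfile (1 / (2 + ρ)) 0 V P' →
      ∃ C : ℝ, ∀ r : ℝ, 1 ≤ r → ∀ y y' : EuclideanSpace ℝ (Fin 3), ‖y‖ ≤ r → ‖y'‖ ≤ r →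
        selfSimilarBernoulli (1 / (2 + ρ)) 0 V P' y - selfSimilarBernoulli (1 / (2 + ρ)) 0 V P' y' ≤ C * r ^ θ)
    (hhover : ∀ c' : ℝ, 0 < c' → ∃ x₀ : EuclideanSpace ℝ (Fin 3), ∃ r : ℝ, 0 < r ∧ ∃ R₀ : ℝ,
      ∀ R : ℝ, R₀ ≤ R → ∀ (V' : EuclideanSpace ℝ (Fin 3) → EuclideanSpace ℝ (Fin 3)) (K Rbig : ℝ), ContDiff ℝ 2 V' →
        (∀ y, ‖fderiv ℝ V' y‖ ≤ K) → 2 * R < Rbig → (∀ w ∈ ball (0 : EuclideanSpace ℝ (Fin 3)) Rbig, V' w = V w) →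
        (volume (ball x₀ r ∩ {a | ∀ σ ∈ Icc 0 (c' * R ^ (2 + ρ)),
            ‖ODE.evolutionMap (fun _ : ℝ => selfSimilarTransport (1 / (2 + ρ)) 0 V') 0 (-σ) a‖ ≤ 2 * R} ∩
          {a | c' * R ^ (2 + ρ) / 2 ≤ (volume {σ ∈ Icc 0 (c' * R ^ (2 + ρ)) |
            ‖selfSimilarTransport (1 / (2 + ρ)) 0 V'
                (ODE.evolutionMap (fun _ : ℝ => selfSimilarTransport (1 / (2 + ρ)) 0 V') 0 (-σ) a)‖ <
              R ^ (-((2 + ρ - θ) / 4))}).toReal})).toReal ≤ (volume (ball x₀ r)).toReal / 4) :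
    uncurry u =ᵐ[volume.restrict (Iio (0 : ℝ) ×ˢ (univ : Set (EuclideanSpace ℝ (Fin 3))))] 0 := by
  -- boilerplate: the classical pressure of the `C²` profile (as in `…NeedleRaceMember`)
  have hρ1' : ρ < 1 := by linarith
  have h2ρ : (0 : ℝ) < 2 + ρ := by linarith
  have hγ : (0 : ℝ) < 1 / (2 + ρ) := one_div_pos.2 h2ρ
  have hγ2 : 1 / (2 + ρ) < 1 / 2 := one_div_lt_one_div_of_lt two_pos (by linarith)
  have hD : ∀ a : ℝ, 0 < a → ENNReal.ofReal (a ^ (2 * ρ)) *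
      cknD a (0 : ℝ × EuclideanSpace ℝ (Fin 3)) p ≤ (c : ℝ≥0∞) :=
    fun a ha => le_trans le_add_self (hgauge a ha)
  have hpm : AEStronglyMeasurable (uncurry p)
      (volume.restrict (Iio (0 : ℝ) ×ˢ (univ : Set (EuclideanSpace ℝ (Fin 3))))) := by
    have := hsw.distributional.2.2.1.aestronglyMeasurable
    simpa [slab] using this
  have hPm := aestronglyMeasurable_pressureProfile hpm hp
  have hDprof := profile_pressure_weight_of_gaugeD hρ hρ1' hpm hp hD
  have hP1 : LocallyIntegrable P volume :=
    EnergySaturation.locallyIntegrable_pressure_of_weight hρ1' hPm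
      (ENNReal.mul_ne_top ENNReal.ofReal_ne_top ENNReal.coe_ne_top) hDprof
  obtain ⟨P', hprof⟩ :=
    WeakToClassical.exists_isSelfSimilarEulerProfile_of_contDiff hsw.distributional hu hp hV hP1
  obtain ⟨C, hoscC⟩ := hosc P' hprof
  have hC0 : 0 ≤ C := nonneg_of_bernoulliOsc hoscC
  -- the clock at every strength `c′ R^{2+ρ}` by the clock reduction
  refine selfSimilar_ae_eq_zero_of_localPowerClockC2 hρ hρ1 hsw hH hgauge hu hp hV (fun c' hc' => ?_)
  obtain ⟨x₀, r, hr, R₀, hR₀⟩ := hhover c' hc'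
  have h12 : 0 < 1 - 2 * (1 / (2 + ρ)) := by linarith
  obtain ⟨R₁, hR₁⟩ := room_of_lt (ρ := ρ) hθ hC0 (mul_pos h12 hc')
  have hroom : ∃ R₁ : ℝ, ∀ R : ℝ, R₁ ≤ R →
      (2 : ℝ) ^ (2 + θ) * C * R ^ θ ≤ (1 - 2 * (1 / (2 + ρ))) * c' * (R ^ (-((2 + ρ - θ) / 4))) ^ 2 * R ^ (2 + ρ) :=
    ⟨max R₁ 1, fun R hR => by
      have h := hR₁ R ((le_max_left _ _).trans hR)
      linarith [h]⟩
  exact ⟨x₀, effectiveClockAt_of_hoveringLawAt (e := 2 + ρ) hprof hγ2 hc' hoscC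
    (fun R hR => Real.rpow_pos_of_pos (by linarith) _) hroom hr hR₀⟩

end Member

section Past

variable {ρ T T₁ : ℝ} {V : EuclideanSpace ℝ (Fin 3) → EuclideanSpace ℝ (Fin 3)}
  {u : ℝ → EuclideanSpace ℝ (Fin 3) → EuclideanSpace ℝ (Fin 3)} {p : ℝ → EuclideanSpace ℝ (Fin 3) → ℝ}
  {H : ℝ → EuclideanSpace ℝ (Fin 3) → EuclideanSpace ℝ (Fin 3) →L[ℝ] EuclideanSpace ℝ (Fin 3)} {c : ℝ≥0}
  {P : EuclideanSpace ℝ (Fin 3) → ℝ}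

/-- **THE HOVERING THRESHOLD AT ONE BALL, PAST-EXACT TWIN.**  = `selfSimilar_ae_eq_zero_of_hoveringLawC2_past` with `∀ x₀, curl V x₀ ≠ 0 → ∃ r …` replaced by
`∃ x₁ r …`; closes through `selfSimilar_ae_eq_zero_of_localPowerClockC2_past`. [cite: ConstantinIgnatovaVicol2026Putative, §3.4.2 eq. (3.31)] -/
theorem selfSimilar_ae_eq_zero_of_localHoveringLawC2_past (hρ : 0 < ρ) (hρh : ρ ≤ 1 / 2) (hT₁ : T₁ ≤ 0) (hTT₁ : T₁ ≤ T)
    (x₀ : EuclideanSpace ℝ (Fin 3))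
    (hsw : IsSuitableWeakSolutionOn (slab (EuclideanSpace ℝ (Fin 3)) (Iio 0) isOpen_Iio) 0 0 u p)
    (hH : HasWeakSpatialGradientOn (slab (EuclideanSpace ℝ (Fin 3)) (Iio 0) isOpen_Iio) u H)
    (hgauge : ∀ a : ℝ, 0 < a →
      ENNReal.ofReal (a ^ (2 * ρ)) * cknA a (0 : ℝ × EuclideanSpace ℝ (Fin 3)) u +
          ENNReal.ofReal (a ^ ρ) * cknE a (0 : ℝ × EuclideanSpace ℝ (Fin 3)) H +
        ENNReal.ofReal (a ^ (2 * ρ)) * cknD a (0 : ℝ × EuclideanSpace ℝ (Fin 3)) p ≤ (c : ℝ≥0∞))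
    (hu : ∀ τ : ℝ, τ < T₁ → u τ = fun x => selfSimilarCollapse (1 / (2 + ρ)) T V τ (x - x₀))
    (hp : ∀ τ : ℝ, τ < T₁ → p τ = fun x => selfSimilarCollapsePressure (1 / (2 + ρ)) T P τ (x - x₀))
    (hV : ContDiff ℝ 2 V) {θ : ℝ} (hθ : θ < 2 + ρ)
    (hosc : ∀ P' : EuclideanSpace ℝ (Fin 3) → ℝ, IsSelfSimilarEulerProfile (1 / (2 + ρ)) 0 V P' →
      ∃ C : ℝ, ∀ r : ℝ, 1 ≤ r → ∀ y y' : EuclideanSpace ℝ (Fin 3), ‖y‖ ≤ r → ‖y'‖ ≤ r →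
        selfSimilarBernoulli (1 / (2 + ρ)) 0 V P' y - selfSimilarBernoulli (1 / (2 + ρ)) 0 V P' y' ≤ C * r ^ θ)
    (hhover : ∀ c' : ℝ, 0 < c' → ∃ x₁ : EuclideanSpace ℝ (Fin 3), ∃ r : ℝ, 0 < r ∧ ∃ R₀ : ℝ,
      ∀ R : ℝ, R₀ ≤ R → ∀ (V' : EuclideanSpace ℝ (Fin 3) → EuclideanSpace ℝ (Fin 3)) (K Rbig : ℝ), ContDiff ℝ 2 V' →
        (∀ y, ‖fderiv ℝ V' y‖ ≤ K) → 2 * R < Rbig → (∀ w ∈ ball (0 : EuclideanSpace ℝ (Fin 3)) Rbig, V' w = V w) →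
        (volume (ball x₁ r ∩ {a | ∀ σ ∈ Icc 0 (c' * R ^ (2 + ρ)),
            ‖ODE.evolutionMap (fun _ : ℝ => selfSimilarTransport (1 / (2 + ρ)) 0 V') 0 (-σ) a‖ ≤ 2 * R} ∩
          {a | c' * R ^ (2 + ρ) / 2 ≤ (volume {σ ∈ Icc 0 (c' * R ^ (2 + ρ)) |
            ‖selfSimilarTransport (1 / (2 + ρ)) 0 V'
                (ODE.evolutionMap (fun _ : ℝ => selfSimilarTransport (1 / (2 + ρ)) 0 V') 0 (-σ) a)‖ <
              R ^ (-((2 + ρ - θ) / 4))}).toReal})).toReal ≤ (volume (ball x₁ r)).toReal / 4) :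
    uncurry u =ᵐ[volume.restrict (Iio (0 : ℝ) ×ˢ (univ : Set (EuclideanSpace ℝ (Fin 3))))] 0 := by
  -- adapted from `selfSimilar_ae_eq_zero_of_hoveringLawC2` (…NeedleHoveringMember, ns-ezl-w2 g3): the classical pressure of the
  -- `C²` profile now comes from the far-past extension (`Past.exists_isSelfSimilarEulerProfile`)
  have h2ρ : (0 : ℝ) < 2 + ρ := by linarith
  have hγ2 : 1 / (2 + ρ) < 1 / 2 := one_div_lt_one_div_of_lt two_pos (by linarith)
  obtain ⟨P', hprof⟩ := Past.exists_isSelfSimilarEulerProfile hρ hT₁ hTT₁ hsw.distributional hu hp hV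
  obtain ⟨C, hoscC⟩ := hosc P' hprof
  have hC0 : 0 ≤ C := nonneg_of_bernoulliOsc hoscC
  -- the clock at every strength `c′ R^{2+ρ}` by the clock reduction, then the past power-clock kill
  refine selfSimilar_ae_eq_zero_of_localPowerClockC2_past hρ hρh hT₁ hTT₁ x₀ hsw hH hgauge hu hp hV (fun c' hc' => ?_)
  obtain ⟨x₁, r, hr, R₀, hR₀⟩ := hhover c' hc'
  have h12 : 0 < 1 - 2 * (1 / (2 + ρ)) := by linarith
  obtain ⟨R₁, hR₁⟩ := room_of_lt (ρ := ρ) hθ hC0 (mul_pos h12 hc')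
  have hroom : ∃ R₁ : ℝ, ∀ R : ℝ, R₁ ≤ R →
      (2 : ℝ) ^ (2 + θ) * C * R ^ θ ≤ (1 - 2 * (1 / (2 + ρ))) * c' * (R ^ (-((2 + ρ - θ) / 4))) ^ 2 * R ^ (2 + ρ) :=
    ⟨max R₁ 1, fun R hR => by
      have h := hR₁ R ((le_max_left _ _).trans hR)
      linarith [h]⟩
  exact ⟨x₁, effectiveClockAt_of_hoveringLawAt (e := 2 + ρ) hprof hγ2 hc' hoscC
    (fun R hR => Real.rpow_pos_of_pos (by linarith) _) hroom hr hR₀⟩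

end Past

end Summit.NavierStokesRegularity.NavierStokesRegularity.Theorems.PowerGaugeEulerLiouville.NeedleRace

end
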